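import Mathlib.Algebra.MvPolynomial.PDeriv
import Mathlib.LinearAlgebra.Matrix.Adjugate
import Mathlib.RingTheory.Ideal.Operations
import Mathlib.RingTheory.Ideal.Span
import Mathlib.Tactic.LinearCombination
import Mathlib.Tactic.Ring
import HarnessLib

/-!
# Transition determinants: Cramer, and the colon identity `((y) : det N) ⊆ (a)`

Pure commutative algebra behind stub S1 `stub_jacobianColon_eq` of line `gorenstein-ci-seeds`
(crux `PadicSemiregularLift.SemiregularSeedsOnAnchors`): Villaflor, *Periods of complete
intersection algebraic cycles*, Rem. 1 — for the Jacobian ideal `J = (∂F)` of `F = Σ fᵢgᵢ` and the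
transition determinant `P = det (∂ⱼHᵢ)`, `H = (f, g)`, one has `(J : P) = ⟨H⟩`.

Setting of this file: `R` a commutative ring, finitely many elements `a = (aᵢ)`, a square matrix
`N` and `y = N a` (so `(y) ⊆ (a)`); `det N` is the TRANSITION DETERMINANT of the pair
`(y) ⊆ (a)`.

* `det_mul_mem_span_range_mulVec` (Cramer, `adj N · y = det N · a`): `det N · a_l ∈ (y)`, whence
  `(a) ⊆ ((y) : det N)` (`det_mul_mem_span_of_mem_span`).
* `det_sub_det_mem_span`: if `C a = C' a = z` and every `z_k` is a non-zero-divisor modulo the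
  other `z_i`, then `det C ≡ det C' (mod (z))` — exchange the rows one at a time; each step changes
  the determinant by the `k`-th coordinate of a syzygy of `z`.
* `mem_span_of_prod_pow_mul_mem`: `(∏ aᵢ^L) q ∈ (aᵢ^{L+1})ᵢ ⟹ q ∈ (a)`, provided each `a_k` is a
  non-zero-divisor modulo the MIXED IDEALS `(aᵢ^{L+1} (i ∈ S ∖ k), aⱼ (j ∉ S))`.
* `mem_span_of_det_mul_mem_span` (the transition-determinant colon identity, Wiebe; de Smit–Rubin–
  Schoof's form of Tate's theorem): if moreover `aᵢ^{L+1} ∈ (y)` for all `i` (written `B y = (aᵢ^{L+1})ᵢ`),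
  then `((y) : det N) ⊆ (a)`: from `det N · q ∈ (y)` get `det(BN) q ∈ (z)`, `z = (aᵢ^{L+1})ᵢ = (BN) a
  = D a` with `D = diag(aᵢ^L)`, so `det D · q ∈ (z)` and `q ∈ (a)`.

The regularity hypotheses hold for every system of parameters of a regular local ring; they are
discharged in the sequel file (`…JacobianColonEqLocal`). Everything here is proved.
-/

set_option linter.dupNamespace false

universe u

namespace Summit.HodgeConjecture.HodgeConjecture.Theorems.SemiregularSeedsOnAnchors.GorensteinCiSeeds

open Matrix

variable {R : Type u} [CommRing R] {n : Type} [Fintype n] [DecidableEq n]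

/-! ## Cramer: `det N · (a) ⊆ (N a)` -/

/-- **Cramer's rule for ideals**: if `y = C a` then `det C · a_l ∈ (y)` for every `l`
(`adj C · y = det C · a`). [folklore] -/
theorem det_mul_mem_span_range_mulVec (C : Matrix n n R) (a : n → R) (l : n) :
    C.det * a l ∈ Ideal.span (Set.range (C *ᵥ a)) := by
  have h : C.adjugate *ᵥ (C *ᵥ a) = C.det • a := by
    rw [mulVec_mulVec, adjugate_mul, smul_mulVec, one_mulVec]
  have hl := congr_fun h l
  simp only [Pi.smul_apply, smul_eq_mul] at hl
  rw [← hl]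
  exact Submodule.sum_mem _ fun j _ => Ideal.mul_mem_left _ _ (Ideal.subset_span ⟨j, rfl⟩)

/-- `det C · (a) ⊆ (C a)`. [folklore] -/
theorem det_mul_mem_span_of_mem_span (C : Matrix n n R) (a : n → R) {x : R}
    (hx : x ∈ Ideal.span (Set.range a)) : C.det * x ∈ Ideal.span (Set.range (C *ᵥ a)) := by
  obtain ⟨c, rfl⟩ := Ideal.mem_span_range_iff_exists_fun.mp hx
  rw [Finset.mul_sum]
  exact Submodule.sum_mem _ fun j _ => by
    rw [mul_left_comm]
    exact Ideal.mul_mem_left _ _ (det_mul_mem_span_range_mulVec C a j)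

/-- Iterating a non-zero-divisor: if `x w ∈ I ⟹ w ∈ I` then `xᵉ w ∈ I ⟹ w ∈ I`. [folklore] -/
theorem mem_of_pow_mul_mem {I : Ideal R} {x : R} (h : ∀ w, x * w ∈ I → w ∈ I) (e : ℕ) (w : R)
    (hw : x ^ e * w ∈ I) : w ∈ I := by
  induction e generalizing w with
  | zero => simpa using hw
  | succ e ih =>
    refine h w (ih (x * w) ?_)
    have : x ^ e * (x * w) = x ^ (e + 1) * w := by ring
    rwa [this]

/-! ## The determinant modulo `(z)` does not depend on the matrix expressing `z` through `a` -/

/-- The determinant after replacing row `k` by `r` is the `k`-th coordinate of `r · adj C`.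
[folklore] -/
theorem det_updateRow_eq_vecMul_adjugate (C : Matrix n n R) (k : n) (r : n → R) :
    (C.updateRow k r).det = (r ᵥ* C.adjugate) k := by
  rw [← cramer_transpose_apply, cramer_eq_adjugate_mulVec, ← adjugate_transpose, mulVec_transpose]

/-- If `r · a = 0` then `w = r · adj C` is a syzygy of `z = C a`: `w · z = det C (r · a) = 0`.
[folklore] -/
theorem vecMul_adjugate_dotProduct_mulVec (C : Matrix n n R) {a r : n → R} (hr : r ⬝ᵥ a = 0) :
    (r ᵥ* C.adjugate) ⬝ᵥ (C *ᵥ a) = 0 := by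
  rw [← dotProduct_mulVec, mulVec_mulVec, adjugate_mul, smul_mulVec, one_mulVec, dotProduct_smul,
    hr, smul_zero]

/-- A coordinate of a syzygy of `z` lies in `(z)` as soon as `z_k` is a non-zero-divisor modulo
the other `z_i`. [folklore] -/
theorem mem_span_of_dotProduct_eq_zero {z w : n → R} (k : n)
    (hz : ∀ v, z k * v ∈ Ideal.span (z '' {i | i ≠ k}) → v ∈ Ideal.span (z '' {i | i ≠ k}))
    (hw : w ⬝ᵥ z = 0) : w k ∈ Ideal.span (Set.range z) := by
  have hsum : z k * w k = -∑ i ∈ Finset.univ.erase k, w i * z i := by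
    rw [dotProduct, ← Finset.add_sum_erase _ _ (Finset.mem_univ k)] at hw
    linear_combination hw
  have hmem : z k * w k ∈ Ideal.span (z '' {i | i ≠ k}) := by
    rw [hsum]
    refine neg_mem (Submodule.sum_mem _ fun i hi => ?_)
    exact Ideal.mul_mem_left _ _ (Ideal.subset_span ⟨i, (Finset.mem_erase.mp hi).1, rfl⟩)
  exact Ideal.span_mono (Set.image_subset_range _ _) (hz (w k) hmem)

/-- **Independence of the transition determinant modulo `(z)`**: if `C a = C' a = z` and every
`z_k` is a non-zero-divisor modulo `(z_i : i ≠ k)`, then `det C' - det C ∈ (z)`. Proof: pass from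
`C` to `C'` one row at a time; replacing row `k` of a matrix `M` with `M a = z` by the `k`-th row of
`C'` adds `det (M with row k := r)`, `r = C'_k - M_k`, `r · a = 0`, which is the `k`-th coordinate
of the syzygy `r · adj M` of `z`. [folklore] -/
theorem det_sub_det_mem_span (C C' : Matrix n n R) (a z : n → R) (hC : C *ᵥ a = z)
    (hC' : C' *ᵥ a = z)
    (hz : ∀ k v, z k * v ∈ Ideal.span (z '' {i | i ≠ k}) → v ∈ Ideal.span (z '' {i | i ≠ k})) :
    C'.det - C.det ∈ Ideal.span (Set.range z) := by
  classical
  -- the hybrid matrices: rows in `S` from `C'`, the others from `C`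
  let M : Finset n → Matrix n n R := fun S => Matrix.of fun i j => if i ∈ S then C' i j else C i j
  have hrow : ∀ i, C i ⬝ᵥ a = z i := fun i => congr_fun hC i
  have hrow' : ∀ i, C' i ⬝ᵥ a = z i := fun i => congr_fun hC' i
  have hM : ∀ S, M S *ᵥ a = z := by
    intro S
    ext i
    change (fun j => if i ∈ S then C' i j else C i j) ⬝ᵥ a = z i
    by_cases hi : i ∈ S
    · simp only [hi, if_true]
      exact hrow' i
    · simp only [hi, if_false]
      exact hrow i
  suffices h : ∀ S : Finset n, (M S).det - C.det ∈ Ideal.span (Set.range z) by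
    have hMu : M Finset.univ = C' := by
      ext i j
      simp [M]
    simpa [hMu] using h Finset.univ
  intro S
  induction S using Finset.induction_on with
  | empty =>
    have hM0 : M ∅ = C := by
      ext i j
      simp [M]
    rw [hM0, sub_self]
    exact Ideal.zero_mem _
  | insert k S hk ih =>
    have hupd : M (insert k S) = (M S).updateRow k ((M S) k + (C' k - C k)) := by
      ext i j
      simp only [updateRow_apply, M, Matrix.of_apply, Finset.mem_insert, Pi.add_apply,
        Pi.sub_apply]
      by_cases h : i = k
      · subst h
        simp [hk]
      · simp [h]
    have hdet : (M (insert k S)).det = (M S).det + ((C' k - C k) ᵥ* (M S).adjugate) k := by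
      rw [hupd, det_updateRow_add, updateRow_eq_self, det_updateRow_eq_vecMul_adjugate]
    have hr : (C' k - C k) ⬝ᵥ a = 0 := by
      rw [sub_dotProduct, hrow' k, hrow k, sub_self]
    have hwz : ((C' k - C k) ᵥ* (M S).adjugate) ⬝ᵥ z = 0 := by
      rw [← hM S]
      exact vecMul_adjugate_dotProduct_mulVec (M S) hr
    have hw := mem_span_of_dotProduct_eq_zero k (hz k) hwz
    rw [hdet, add_sub_right_comm]
    exact Ideal.add_mem _ ih hw

/-! ## `(∏ aᵢ^L) q ∈ (aᵢ^{L+1}) ⟹ q ∈ (a)`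

The MIXED IDEAL of `T, S ⊆ n` is `(aᵢ^{L+1} (i ∈ T), aⱼ (j ∉ S))`, written
`Ideal.span ((fun i => a i ^ (L + 1)) '' ↑T) ⊔ Ideal.span (a '' (↑S)ᶜ)`. -/

omit [Fintype n] in
/-- **`(∏_{i ∈ S} aᵢ^L) q ∈ (aᵢ^{L+1} (i ∈ S), aⱼ (j ∉ S)) ⟹ q ∈ (a)`**, provided each `a_k`
(`k ∈ S'`) is a non-zero-divisor modulo the mixed ideal `(aᵢ^{L+1} (i ∈ S' ∖ k), aⱼ (j ∉ S'))`:
induction on `S`, peeling off one `a_k^L` at a time. [folklore] -/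
theorem mem_span_of_prod_pow_mul_mem_mixed (a : n → R) (L : ℕ)
    (hreg : ∀ (S : Finset n) (k : n), k ∈ S → ∀ w,
      a k * w ∈ Ideal.span ((fun i => a i ^ (L + 1)) '' ↑(S.erase k)) ⊔ Ideal.span (a '' (↑S)ᶜ) →
      w ∈ Ideal.span ((fun i => a i ^ (L + 1)) '' ↑(S.erase k)) ⊔ Ideal.span (a '' (↑S)ᶜ))
    (S : Finset n) : ∀ q : R,
      (∏ i ∈ S, a i ^ L) * q ∈ Ideal.span ((fun i => a i ^ (L + 1)) '' ↑S) ⊔ Ideal.span (a '' (↑S)ᶜ) →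
      q ∈ Ideal.span (Set.range a) := by
  induction S using Finset.induction_on with
  | empty =>
    intro q hq
    rw [Finset.prod_empty, one_mul] at hq
    refine (sup_le ?_ ?_ : Ideal.span ((fun i => a i ^ (L + 1)) '' ↑(∅ : Finset n)) ⊔
      Ideal.span (a '' (↑(∅ : Finset n))ᶜ) ≤ Ideal.span (Set.range a)) hq
    · simp
    · exact Ideal.span_mono (Set.image_subset_range _ _)
  | insert k S₀ hk ih =>
    intro q hq
    rw [Finset.prod_insert hk, mul_assoc] at hq
    set w := (∏ i ∈ S₀, a i ^ L) * q with hw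
    -- `a_k^L w ∈ (a_k^{L+1}) + I'`, `I' = (aᵢ^{L+1} (i ∈ S₀), aⱼ (j ∉ S₀ ∪ {k}))`
    set I' : Ideal R := Ideal.span ((fun i => a i ^ (L + 1)) '' ↑S₀) ⊔
      Ideal.span (a '' (↑(insert k S₀))ᶜ) with hI'
    have hle : Ideal.span ((fun i => a i ^ (L + 1)) '' ↑(insert k S₀)) ⊔
        Ideal.span (a '' (↑(insert k S₀))ᶜ) ≤ Ideal.span {a k ^ (L + 1)} ⊔ I' := by
      refine sup_le (Ideal.span_le.mpr ?_) (le_sup_right.trans le_sup_right)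
      rintro _ ⟨i, hi, rfl⟩
      rcases Finset.mem_insert.mp (Finset.mem_coe.mp hi) with rfl | hi
      · exact Ideal.mem_sup_left (Ideal.mem_span_singleton_self _)
      · exact Ideal.mem_sup_right (Ideal.mem_sup_left (Ideal.subset_span ⟨i, Finset.mem_coe.mpr hi, rfl⟩))
    obtain ⟨c, b, hb, hcb⟩ := Ideal.mem_span_singleton_sup.mp (hle hq)
    have hb' : a k ^ L * (w - a k * c) = b := by linear_combination -hcb
    have hreg' := hreg (insert k S₀) k (Finset.mem_insert_self k S₀)
    rw [Finset.erase_insert hk] at hreg'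
    have hwc : w - a k * c ∈ I' := mem_of_pow_mul_mem hreg' L _ (hb' ▸ hb)
    -- hence `w ∈ I' + (a_k) ⊆ (aᵢ^{L+1} (i ∈ S₀), aⱼ (j ∉ S₀))`
    have hI'le : I' ≤ Ideal.span ((fun i => a i ^ (L + 1)) '' ↑S₀) ⊔ Ideal.span (a '' (↑S₀)ᶜ) :=
      sup_le_sup le_rfl (Ideal.span_mono (Set.image_mono (Set.compl_subset_compl.mpr
        (Finset.coe_subset.mpr (Finset.subset_insert k S₀)))))
    have hak : a k ∈ Ideal.span ((fun i => a i ^ (L + 1)) '' ↑S₀) ⊔ Ideal.span (a '' (↑S₀)ᶜ) :=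
      Ideal.mem_sup_right (Ideal.subset_span ⟨k, fun h => hk (Finset.mem_coe.mp h), rfl⟩)
    have hwmem : w ∈ Ideal.span ((fun i => a i ^ (L + 1)) '' ↑S₀) ⊔ Ideal.span (a '' (↑S₀)ᶜ) := by
      have : w = (w - a k * c) + a k * c := by ring
      rw [this]
      exact Ideal.add_mem _ (hI'le hwc) (Ideal.mul_mem_right _ _ hak)
    exact ih q hwmem

/-- **`(∏ᵢ aᵢ^L) q ∈ (a₁^{L+1}, …, aₙ^{L+1}) ⟹ q ∈ (a₁, …, aₙ)`** under the non-zero-divisor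
hypotheses on the mixed ideals. [folklore] -/
theorem mem_span_of_prod_pow_mul_mem (a : n → R) (L : ℕ)
    (hreg : ∀ (S : Finset n) (k : n), k ∈ S → ∀ w,
      a k * w ∈ Ideal.span ((fun i => a i ^ (L + 1)) '' ↑(S.erase k)) ⊔ Ideal.span (a '' (↑S)ᶜ) →
      w ∈ Ideal.span ((fun i => a i ^ (L + 1)) '' ↑(S.erase k)) ⊔ Ideal.span (a '' (↑S)ᶜ))
    (q : R) (hq : (∏ i, a i ^ L) * q ∈ Ideal.span (Set.range fun i => a i ^ (L + 1))) :
    q ∈ Ideal.span (Set.range a) := by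
  refine mem_span_of_prod_pow_mul_mem_mixed a L hreg Finset.univ q (Ideal.mem_sup_left ?_)
  refine (Ideal.span_mono ?_ : _ ≤ Ideal.span _) hq
  rintro _ ⟨i, rfl⟩
  exact ⟨i, Finset.mem_coe.mpr (Finset.mem_univ i), rfl⟩

/-! ## The colon identity `((y) : det N) ⊆ (a)` -/

omit [CommRing R] in
/-- `{i | i ≠ k}` as the image locus of the mixed ideal at `S = univ`. [folklore] -/
theorem image_coe_univ_erase (f : n → R) (k : n) :
    f '' ↑(Finset.univ.erase k) = f '' {i | i ≠ k} := by
  rw [Finset.coe_erase, Finset.coe_univ]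
  congr 1
  ext i
  simp

/-- **The transition-determinant colon identity** (`((y) : det N) ⊆ (a)`): let `y = N a`,
suppose `aᵢ^{L+1} ∈ (y)` for all `i`, written `B y = (aᵢ^{L+1})ᵢ`, and suppose each `a_k` is a
non-zero-divisor modulo every mixed ideal `(aᵢ^{L+1} (i ∈ S ∖ k), aⱼ (j ∉ S))`. Then
`det N · q ∈ (y)` implies `q ∈ (a)`. (With Cramer, `((y) : det N) = (a)`: the algebraic heart of
Villaflor's Remark 1, `(J^F : det Jac(H)) = ⟨H⟩`.) [cite: Villaflor2022PeriodsCI, Rem 1] -/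
theorem mem_span_of_det_mul_mem_span :
    ∀ (R : Type u) [CommRing R] (n : Type) [Fintype n] [DecidableEq n] (a : n → R)
      (N : Matrix n n R) (B : Matrix n n R) (L : ℕ)
      (_ : Matrix.mulVec B (Matrix.mulVec N a) = fun i => a i ^ (L + 1))
      (_ : ∀ (S : Finset n) (k : n), k ∈ S → ∀ (w : R),
        a k * w ∈ Ideal.span ((fun i => a i ^ (L + 1)) '' ↑(S.erase k)) ⊔ Ideal.span (a '' (↑S)ᶜ) →
        w ∈ Ideal.span ((fun i => a i ^ (L + 1)) '' ↑(S.erase k)) ⊔ Ideal.span (a '' (↑S)ᶜ))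
      (q : R) (_ : N.det * q ∈ Ideal.span (Set.range (Matrix.mulVec N a))),
      q ∈ Ideal.span (Set.range a) := by
  intro R _ n _ _ a N B L hB hreg q hq
  set z : n → R := fun i => a i ^ (L + 1) with hz
  have hBN : (B * N) *ᵥ a = z := by rw [← mulVec_mulVec, hB]
  have hD : Matrix.diagonal (fun i => a i ^ L) *ᵥ a = z := by
    ext i
    rw [mulVec_diagonal, hz, ← pow_succ]
  -- `z_k` is a non-zero-divisor modulo the other `z_i`
  have hzreg : ∀ k v, z k * v ∈ Ideal.span (z '' {i | i ≠ k}) →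
      v ∈ Ideal.span (z '' {i | i ≠ k}) := by
    intro k v hv
    have hk := hreg Finset.univ k (Finset.mem_univ k)
    rw [image_coe_univ_erase, Finset.coe_univ, Set.compl_univ, Set.image_empty, Ideal.span_empty,
      sup_bot_eq] at hk
    exact mem_of_pow_mul_mem hk (L + 1) v hv
  -- `det (BN) q ∈ (z)`
  have h3 : (B * N).det * q ∈ Ideal.span (Set.range z) := by
    rw [det_mul, mul_assoc, ← hB]
    exact det_mul_mem_span_of_mem_span B (N *ᵥ a) hq
  -- `det (BN) ≡ det D (mod (z))`, hence `(∏ aᵢ^L) q ∈ (z)`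
  have h4 := det_sub_det_mem_span (Matrix.diagonal fun i => a i ^ L) (B * N) a z hD hBN hzreg
  have h5 : (Matrix.diagonal fun i => a i ^ L).det * q ∈ Ideal.span (Set.range z) := by
    have : (Matrix.diagonal fun i => a i ^ L).det * q =
        (B * N).det * q - ((B * N).det - (Matrix.diagonal fun i => a i ^ L).det) * q := by ring
    rw [this]
    exact Ideal.sub_mem _ h3 (Ideal.mul_mem_right _ _ h4)
  rw [det_diagonal] at h5
  exact mem_span_of_prod_pow_mul_mem a L hreg q h5

end Summit.HodgeConjecture.HodgeConjecture.Theorems.SemiregularSeedsOnAnchors.GorensteinCiSeeds
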